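import Summits.FinalStateConjecture.FinalStateConjecture.Theses.BurnettKineticRigidity

/-!
# Late-time Burnett precompactness (route BurnettKineticRigidity, support item
`LateTimeBurnettPrecompactness`, stmt-FinalStateConjecture-14100)

The soft (Arzelà–Ascoli) half of late-time Burnett compactness: for a spacetime `𝓢` and a chart
`Ψ` of the Kerr–Schild domain of `Kerr.background M a` whose pulled-back components are `C¹` on
the open domain, uniform `C¹` bounds of the translates `g_T = (Ψ^* g)(· + T ∂₀)`, `T ≥ 0`, on the
open slab `S_L = {τ₀ < t* < τ₀ + L}` (`HasUniformBurnettBounds`) imply that every sequence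
`T_n → ∞` has a subsequence along which `g_{T_n}` Burnett-converges on `S_L` (`BurnettConverges`:
locally uniformly with equi-Lipschitz bounds) to some `g_∞`.

Proof: the mean value inequality on balls of the open slab turns the bound `‖∂g_T‖ ≤ C` into a
uniform Lipschitz bound; a dense sequence of `E4` and Tychonoff compactness of the countable
product of closed balls give a subsequence converging pointwise on a dense subset of the slab;
the equi-Lipschitz bound makes the subsequence Cauchy at every point of the slab and upgrades
pointwise convergence to locally uniform convergence (Hale 1980, Ch. I, §8; Huneau–Luk
arXiv:2403.03470, Remark 1.3; Burnett 1989). The generic statements are kept in Mathlib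
generality (separable real normed source, proper real normed target).
-/

-- every `Summit.FinalStateConjecture.FinalStateConjecture.…` name repeats the summit = sub-problem
-- segment (D-0017 layout, CONVENTIONS §2; lakefile sets it for the library build, a standalone
-- elaboration of this file does not see that option); the duplicate is deliberate.
set_option linter.dupNamespace false

noncomputable section

open Filter Set Metric Topology
open scoped NNReal ENNReal Topology ContDiff

namespace Summit.FinalStateConjecture.FinalStateConjecture.Theorems

open Literature.Geometry.Lorentzian

section Generic

variable {E F : Type*} [NormedAddCommGroup E] [NormedAddCommGroup F]

/-- A pointwise limit on `s` of maps which are `C`-Lipschitz on `s` is `C`-Lipschitz on `s`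
(the reason Burnett limits are Lipschitz; cf. `BurnettConverges.exists_lipschitzOnWith_limit`). -/
theorem lipschitzOnWith_of_tendsto_of_lipschitzOnWith {s : Set E} {C : ℝ≥0} {g : ℕ → E → F}
    {g₀ : E → F} (hL : ∀ n, LipschitzOnWith C (g n) s)
    (hlim : ∀ x ∈ s, Tendsto (fun n ↦ g n x) atTop (𝓝 (g₀ x))) : LipschitzOnWith C g₀ s := by
  refine LipschitzOnWith.of_dist_le_mul fun y hy z hz ↦ ?_
  have h : Tendsto (fun n ↦ dist (g n y) (g n z)) atTop (𝓝 (dist (g₀ y) (g₀ z))) :=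
    (hlim y hy).dist (hlim z hz)
  exact le_of_tendsto' h fun n ↦ (hL n).dist_le_mul y hy z hz

variable [TopologicalSpace.SeparableSpace E] [ProperSpace F]

/-- **Soft Arzelà–Ascoli in Burnett's form** (Hale 1980, Ch. I, §8; Huneau–Luk arXiv:2403.03470,
Remark 1.3). On an open set `U` of a separable real normed space, a sequence of maps into a proper
real normed space which is uniformly bounded on `U` and uniformly `C`-Lipschitz on every ball
contained in `U` has a subsequence converging in Burnett's sense on `U` (locally uniformly, with
equi-Lipschitz bounds, `BurnettConverges`) to some limit map. Proof: Tychonoff compactness of the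
countable product of closed balls indexed by the members of a dense sequence lying in `U` gives a
subsequence converging on a dense subset; the equi-Lipschitz bound makes it Cauchy everywhere on
`U` and upgrades pointwise to locally uniform convergence. -/
theorem exists_subseq_burnettConverges_of_lipschitzOnWith_ball {U : Set E} (hU : IsOpen U)
    {g : ℕ → E → F} {C : ℝ≥0} (hb : ∀ n, ∀ x ∈ U, ‖g n x‖ ≤ C)
    (hL : ∀ (n : ℕ) (x : E) (r : ℝ), ball x r ⊆ U → LipschitzOnWith C (g n) (ball x r)) :
    ∃ φ : ℕ → ℕ, StrictMono φ ∧ ∃ g₀ : E → F, BurnettConverges U (g ∘ φ) g₀ := by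
  -- a dense sequence of `E` and the countable index set of its members inside `U`
  obtain ⟨d, hd⟩ := TopologicalSpace.exists_dense_seq E
  let ι := {k : ℕ // d k ∈ U}
  let v : ℕ → ι → F := fun n k ↦ g n (d k.1)
  have hK : IsCompact (Set.pi univ fun _ : ι ↦ closedBall (0 : F) C) :=
    isCompact_univ_pi fun _ ↦ isCompact_closedBall _ _
  have hv : ∀ n, v n ∈ Set.pi univ fun _ : ι ↦ closedBall (0 : F) C := fun n k _ ↦
    mem_closedBall_zero_iff.2 (hb n (d k.1) k.2)
  -- Tychonoff + first countability of the countable product: a pointwise convergent subsequence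
  obtain ⟨w, -, φ, hφ, hw⟩ := hK.tendsto_subseq hv
  have hwk : ∀ k : ι, Tendsto (fun n ↦ g (φ n) (d k.1)) atTop (𝓝 (w k)) := fun k ↦
    tendsto_pi_nhds.1 hw k
  -- small balls inside `U` containing a member of the dense sequence
  have key : ∀ x ∈ U, ∀ ε > (0 : ℝ), ∃ δ > (0 : ℝ), ball x δ ⊆ U ∧ (C : ℝ) * δ ≤ ε / 4 ∧
      ∃ k : ι, d k.1 ∈ ball x δ := by
    intro x hx ε hε
    obtain ⟨r, hr, hrU⟩ := Metric.isOpen_iff.1 hU x hx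
    obtain ⟨δ₀, hδ₀, hCδ₀⟩ := exists_pos_mul_lt (show (0 : ℝ) < ε / 4 by positivity) (C : ℝ)
    have hpos : 0 < min r δ₀ := lt_min hr hδ₀
    refine ⟨min r δ₀, hpos, (ball_subset_ball (min_le_left _ _)).trans hrU, ?_, ?_⟩
    · calc (C : ℝ) * min r δ₀ ≤ C * δ₀ := by
            gcongr
            exact min_le_right _ _
        _ ≤ ε / 4 := hCδ₀.le
    · obtain ⟨y, ⟨k, rfl⟩, hy⟩ :=
        Dense.exists_mem_open hd isOpen_ball ⟨x, mem_ball_self hpos⟩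
      exact ⟨⟨k, hrU ((ball_subset_ball (min_le_left _ _)) hy)⟩, hy⟩
  -- the subsequence is Cauchy at every point of `U`
  have hcauchy : ∀ x ∈ U, CauchySeq fun n ↦ g (φ n) x := by
    intro x hx
    refine Metric.cauchySeq_iff.2 fun ε hε ↦ ?_
    obtain ⟨δ, hδ, hδU, hCδ, k, hk⟩ := key x hx ε hε
    obtain ⟨N, hN⟩ := Metric.cauchySeq_iff.1 (hwk k).cauchySeq (ε / 2) (half_pos hε)
    refine ⟨N, fun m hm n hn ↦ ?_⟩
    have hxball : x ∈ ball x δ := mem_ball_self hδ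
    have h1 : dist (g (φ m) x) (g (φ m) (d k.1)) ≤ C * δ := by
      refine ((hL (φ m) x δ hδU).dist_le_mul x hxball (d k.1) hk).trans ?_
      gcongr
      rw [dist_comm]
      exact (mem_ball.1 hk).le
    have h2 : dist (g (φ n) (d k.1)) (g (φ n) x) ≤ C * δ := by
      refine ((hL (φ n) x δ hδU).dist_le_mul (d k.1) hk x hxball).trans ?_
      gcongr
      exact (mem_ball.1 hk).le
    calc dist (g (φ m) x) (g (φ n) x)
        ≤ dist (g (φ m) x) (g (φ m) (d k.1)) + dist (g (φ m) (d k.1)) (g (φ n) (d k.1)) +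
          dist (g (φ n) (d k.1)) (g (φ n) x) := dist_triangle4 _ _ _ _
      _ < C * δ + ε / 2 + C * δ :=
          add_lt_add_of_lt_of_le (add_lt_add_of_le_of_lt h1 (hN m hm n hn)) h2
      _ ≤ ε := by linarith
  -- the limit map
  let g₀ : E → F := fun x ↦ limUnder atTop fun n ↦ g (φ n) x
  have hpt : ∀ x ∈ U, Tendsto (fun n ↦ g (φ n) x) atTop (𝓝 (g₀ x)) := fun x hx ↦
    tendsto_nhds_limUnder (cauchySeq_tendsto_of_complete (hcauchy x hx))
  refine ⟨φ, hφ, g₀, ⟨?_, ?_⟩⟩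
  · -- locally uniform convergence from pointwise convergence and the equi-Lipschitz bound
    refine Metric.tendstoLocallyUniformlyOn_iff.2 fun ε hε x hx ↦ ?_
    obtain ⟨δ, hδ, hδU, hCδ, -, -⟩ := key x hx ε hε
    refine ⟨ball x δ, mem_nhdsWithin_of_mem_nhds (ball_mem_nhds x hδ), ?_⟩
    have hL₀ : LipschitzOnWith C g₀ (ball x δ) :=
      lipschitzOnWith_of_tendsto_of_lipschitzOnWith (fun n ↦ hL (φ n) x δ hδU)
        fun y hy ↦ hpt y (hδU hy)
    filter_upwards [Metric.tendsto_nhds.1 (hpt x hx) (ε / 2) (half_pos hε)] with n hn y hy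
    have hxball : x ∈ ball x δ := mem_ball_self hδ
    have h1 : dist (g₀ y) (g₀ x) ≤ C * δ := by
      refine (hL₀.dist_le_mul y hy x hxball).trans ?_
      gcongr
      exact (mem_ball.1 hy).le
    have h2 : dist (g (φ n) x) (g (φ n) y) ≤ C * δ := by
      refine ((hL (φ n) x δ hδU).dist_le_mul x hxball y hy).trans ?_
      gcongr
      rw [dist_comm]
      exact (mem_ball.1 hy).le
    have h3 : dist (g₀ x) (g (φ n) x) < ε / 2 := by rwa [dist_comm] at hn
    calc dist (g₀ y) ((g ∘ φ) n y)
        ≤ dist (g₀ y) (g₀ x) + dist (g₀ x) (g (φ n) x) + dist (g (φ n) x) (g (φ n) y) :=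
          dist_triangle4 _ _ _ _
      _ < C * δ + ε / 2 + C * δ := add_lt_add_of_lt_of_le (add_lt_add_of_le_of_lt h1 h3) h2
      _ ≤ ε := by linarith
  · -- equi-Lipschitz bound on a ball around each point
    intro x hx
    obtain ⟨r, hr, hrU⟩ := Metric.isOpen_iff.1 hU x hx
    exact ⟨C, ball x r, mem_nhdsWithin_of_mem_nhds (ball_mem_nhds x hr),
      fun n ↦ hL (φ n) x r hrU⟩

variable [NormedSpace ℝ E] [NormedSpace ℝ F]

/-- **Soft Arzelà–Ascoli, `C¹` form** (Huneau–Luk arXiv:2403.03470, Remark 1.3: "the original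
conjecture only requires `supₙ |∂gₙ| < ∞`"). On an open set `U`, a sequence of maps which are
differentiable at the points of `U` with `‖gₙ‖ ≤ C` and `‖Dgₙ‖ ≤ C` on `U` has a subsequence
Burnett-converging on `U`: the mean value inequality on balls inside `U` supplies the uniform
Lipschitz bound of `exists_subseq_burnettConverges_of_lipschitzOnWith_ball`. -/
theorem exists_subseq_burnettConverges_of_norm_fderiv_le {U : Set E} (hU : IsOpen U)
    {g : ℕ → E → F} {C : ℝ≥0} (hd : ∀ n, ∀ x ∈ U, DifferentiableAt ℝ (g n) x)
    (hb : ∀ n, ∀ x ∈ U, ‖g n x‖ ≤ C) (hD : ∀ n, ∀ x ∈ U, ‖fderiv ℝ (g n) x‖ ≤ C) :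
    ∃ φ : ℕ → ℕ, StrictMono φ ∧ ∃ g₀ : E → F, BurnettConverges U (g ∘ φ) g₀ := by
  refine exists_subseq_burnettConverges_of_lipschitzOnWith_ball hU hb fun n x r hr ↦ ?_
  refine (convex_ball x r).lipschitzOnWith_of_nnnorm_fderiv_le (fun y hy ↦ hd n y (hr hy))
    fun y hy ↦ ?_
  rw [← NNReal.coe_le_coe, coe_nnnorm]
  exact hD n y (hr hy)

/-- **Soft Arzelà–Ascoli, sup-norm form**: on an open set `U`, a sequence of maps differentiable
at the points of `U` whose `C¹` sup norms `supCkENorm U 1 gₙ` (`KerrConvergence.lean`) are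
bounded by one constant has a Burnett-convergent subsequence on `U`
(Huneau–Luk arXiv:2403.03470, Remark 1.3). -/
theorem exists_subseq_burnettConverges_of_supCkENorm_one_le {U : Set E} (hU : IsOpen U)
    {g : ℕ → E → F} {C : ℝ≥0} (hd : ∀ n, ∀ x ∈ U, DifferentiableAt ℝ (g n) x)
    (hb : ∀ n, supCkENorm U 1 (g n) ≤ C) :
    ∃ φ : ℕ → ℕ, StrictMono φ ∧ ∃ g₀ : E → F, BurnettConverges U (g ∘ φ) g₀ := by
  refine exists_subseq_burnettConverges_of_norm_fderiv_le (C := C) hU hd (fun n x hx ↦ ?_)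
    fun n x hx ↦ ?_
  · have h0 := (enorm_iteratedFDeriv_le_supCkENorm (Nat.zero_le 1) hx (g n)).trans (hb n)
    rw [enorm_le_coe, ← NNReal.coe_le_coe, coe_nnnorm, norm_iteratedFDeriv_zero] at h0
    exact h0
  · have h1 := (enorm_iteratedFDeriv_le_supCkENorm (le_refl 1) hx (g n)).trans (hb n)
    rw [enorm_le_coe, ← NNReal.coe_le_coe, coe_nnnorm, ← norm_iteratedFDeriv_fderiv,
      norm_iteratedFDeriv_zero] at h1
    exact h1

end Generic

/-! ### The slab of the Kerr background and the translates -/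

/-- The open slab `S_L = {τ₀ < t* < τ₀ + L}` of the Kerr background, as a subset of `E4`. -/
theorem image_val_timeSlabIoo_kerr_background (M a τ₀ L : ℝ) :
    Subtype.val '' (Kerr.background M a).timeSlabIoo τ₀ L =
      {x : E4 | x ∈ ((Kerr.background M a).domain : Set E4) ∧ τ₀ < x 0 ∧ x 0 < τ₀ + L} := by
  ext x
  simp only [mem_image, ModelBackground.mem_timeSlabIoo, mem_setOf_eq]
  constructor
  · rintro ⟨y, hy, rfl⟩
    exact ⟨y.2, hy⟩
  · rintro ⟨hx, h⟩
    exact ⟨⟨x, hx⟩, h, rfl⟩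

/-- The slab `S_L` of the Kerr background is open in `E4`. -/
theorem isOpen_image_val_timeSlabIoo_kerr_background (M a τ₀ L : ℝ) :
    IsOpen (Subtype.val '' (Kerr.background M a).timeSlabIoo τ₀ L) := by
  rw [image_val_timeSlabIoo_kerr_background]
  have h0 : Continuous fun x : E4 ↦ x 0 := PiLp.continuous_apply 2 _ 0
  exact (Kerr.background M a).domain.isOpen.and
    ((isOpen_lt continuous_const h0).and (isOpen_lt h0 continuous_const))

/-- The slab `S_L` lies in the Kerr–Schild domain. -/
theorem image_val_timeSlabIoo_subset_domain (M a τ₀ L : ℝ) :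
    Subtype.val '' (Kerr.background M a).timeSlabIoo τ₀ L ⊆
      ((Kerr.background M a).domain : Set E4) := by
  rintro _ ⟨y, -, rfl⟩
  exact y.2

/-- The translates `g_T = (Ψ^* g)(· + T ∂₀)` of `C¹` chart components are differentiable at every
point of the (stationary) Kerr–Schild domain. -/
theorem differentiableAt_translatedChartMetric (𝓢 : Spacetime.{0} 4) (M a : ℝ)
    (Ψ : (Kerr.background M a).domain → 𝓢.carrier)
    (hΨ : ContDiffOn ℝ 1 (𝓢.chartMetricExtend (Kerr.background M a) Ψ)
      ((Kerr.background M a).domain : Set E4))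
    (T : ℝ) {x : E4} (hx : x ∈ ((Kerr.background M a).domain : Set E4)) :
    DifferentiableAt ℝ (𝓢.translatedChartMetric (Kerr.background M a) Ψ T) x := by
  have hxT : x + T • E4.basisVector 0 ∈ ((Kerr.background M a).domain : Set E4) :=
    ((Kerr.isStationary_background M a).add_mem_iff T x).2 hx
  have hG := (hΨ.differentiableOn one_ne_zero).differentiableAt
    ((Kerr.background M a).domain.isOpen.mem_nhds hxT)
  show DifferentiableAt ℝ
    (fun y ↦ 𝓢.chartMetricExtend (Kerr.background M a) Ψ (y + T • E4.basisVector 0)) x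
  exact (differentiableAt_comp_add_right (T • E4.basisVector 0)).2 hG

/-- **Late-time Burnett precompactness** (route BurnettKineticRigidity, support item
`LateTimeBurnettPrecompactness`): uniform `C¹` bounds of the translates of `C¹` chart components
on the open slab `S_L` imply that every `T_n → ∞` has a subsequence along which the translates
Burnett-converge on `S_L`. Soft Arzelà–Ascoli (Hale 1980, Ch. I, §8; Huneau–Luk
arXiv:2403.03470, Remark 1.3; Burnett 1989): shift the sequence so that `T_n ≥ 0`, then apply
`exists_subseq_burnettConverges_of_supCkENorm_one_le` on the open slab. -/
theorem lateTimeBurnettPrecompactness_proof :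
    Summit.FinalStateConjecture.FinalStateConjecture.Theses.BurnettKineticRigidity.LateTimeBurnettPrecompactness := by
  intro 𝓢 M a τ₀ L Ψ hΨ hB T hT
  obtain ⟨C, hC⟩ := hB
  -- eventually `T n ≥ 0`
  obtain ⟨N, hN⟩ := eventually_atTop.1 (hT.eventually_ge_atTop 0)
  -- the shifted sequence of translates has a Burnett-convergent subsequence on the open slab
  obtain ⟨φ, hφ, g₀, hconv⟩ := exists_subseq_burnettConverges_of_supCkENorm_one_le
    (g := fun n ↦ 𝓢.translatedChartMetric (Kerr.background M a) Ψ (T (n + N)))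
    (isOpen_image_val_timeSlabIoo_kerr_background M a τ₀ L)
    (fun n x hx ↦ differentiableAt_translatedChartMetric 𝓢 M a Ψ hΨ (T (n + N))
      (image_val_timeSlabIoo_subset_domain M a τ₀ L hx))
    (fun n ↦ hC (T (n + N)) (hN _ (Nat.le_add_left N n)))
  exact ⟨fun n ↦ φ n + N, fun m n hmn ↦ Nat.add_lt_add_right (hφ hmn) N, g₀, hconv⟩

end Summit.FinalStateConjecture.FinalStateConjecture.Theorems

end
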